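import Mathlib
import HarnessLib
import HarnessLib.Audit
import Summits.NavierStokesRegularity.Statement
import Literature.Analysis.FluidPDE.ClassicalSolution
import Literature.Analysis.FluidPDE.LerayHopf
import Literature.Analysis.FluidPDE.SuitableWeak
import Summits.NavierStokesRegularity.NavierStokesRegularity.Theorems.TypeICertificateLadderRungZero
import Summits.NavierStokesRegularity.NavierStokesRegularity.Theorems.TypeICertificateLadderLadderGlue
import Summits.NavierStokesRegularity.NavierStokesRegularity.Theorems.TypeICertificateLadderLadderAssembly
import Summits.NavierStokesRegularity.NavierStokesRegularity.Theorems.TypeICertificateLadderRungOneSplice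
import Summits.NavierStokesRegularity.NavierStokesRegularity.Theorems.TypeICertificateLadderRungReynoldsOne
import HarnessLib.Audit.Status.Attr
-- import Summits.NavierStokesRegularity.NavierStokesRegularity.Theorems.TypeICertificateLadderNoBlowupToClay dropped: it (transitively) imports this route file — proofs used by `closes`/`_holds` must live in a module that does not import the Theses file
-- import Summits.NavierStokesRegularity.NavierStokesRegularity.Theorems.TypeICertificateLadderErgodicOptimisationDuality dropped: it (transitively) imports this route file — proofs used by `closes`/`_holds` must live in a module that does not import the Theses file

/-!
Route: TypeICertificateLadder

# Route TypeICertificateLadder — NavierStokesRegularity (Clay A), positive side; realises idea card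
`type-i-certificate-ladder` (absorbing `certified-liouville-thresholds`)

## Thesis X (= crux NoTypeIBlowup, rank 2; no separate target item)
In words: no finite-energy classical solution of unforced NS on ℝ³×[0,T) from a rapidly decaying
datum blows up at T at the Type-I (self-similar) rate; equivalently, for EVERY dimensionless
constant C ("collapse Reynolds number": √(T−t)‖u(t)‖_∞ ≤ C√ν near T) the solution extends past T
(rung X_C; all rungs ⇒ X by the support item LadderGlue).
Lean: ∀ ν T > 0, ∀ u p, IsClassicalNSSolutionOn (Ico 0 T) ν 0 u p → IsLerayHopfOn T ν 0 (u 0) u →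
HasRapidSpatialDecay (u 0) → IsTypeIBlowup u T → HasSmoothExtensionPast ν 0 u T.
It suffices together with the SHARED crux NoTypeII (= stmt-NavierStokesRegularity-0056 of route
TypeILiouville) and the shared frame NoBlowup → Clay A (= stmt-…-0055): Assembly := NoTypeIBlowup →
NoTypeII → NoBlowupToClay → NavierStokesRegularity (pure bookkeeping, checked in the planner's
Sketch.lean).

## The line: a LADDER of certified rungs X_C, C ↑ ∞, with no Liouville theorem
Dictionary (Leray similarity variables at a candidate singular point (T,x₀)): U(s,y) = √(T e^{-s}/ν)
· u(T − T e^{-s}, x₀ + √(ν T e^{-s}) y); Type-I(C) ⇔ ‖U(s)‖_∞ ≤ C eventually; U solves the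
autonomous unit-viscosity profile equation ∂ₛU = ΔU − ½U − ½y·∇U − U·∇U − ∇P. A CERTIFICATE at level
C is a real functional g, bounded on {‖V‖_∞ ≤ C}, with the trajectory inequality  g(U(s₂)) −
g(U(s₁)) + ∫_{s₁}^{s₂} ∫_{|y|<ρ} |U|³ dy ds ≤ δ (s₂ − s₁)  (s₀ ≤ s₁ ≤ s₂) along every Type-I(C)
trajectory, δ below the L³-concentration threshold ε(C). SOUNDNESS (support CertificateSoundness):
telescoping + the crux TypeIConcentration (Barker–Prange-type concentration
‖u(t)‖_{L³(B(x₀,ρ√(ν(T−t))))} ≥ γ at a Type-I singular point, constants depending on C only via the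
support ScaledEnergyBound) give X_C. COMPLETENESS (support ErgodicOptimisationDuality +
NOT-decomposed NS compactness): on the compact forward-invariant profile class the sup over
invariant measures of the witness equals the inf over continuous g of the sup of (witness + g∘Φ_h −
g), so a certificate EXISTS as soon as the level-C Liouville statement holds — failure is a matter
of ansatz degree, never of kind. Rung 0 (support RungZero) is Leray 1934; rung 1 (crux
RungReynoldsOne, C = 1) is the first non-perturbative target, to be found by SDP/SOS over
Gaussian-weighted moments of (U, curl U, P) and verified in interval arithmetic (kit compute;
Verifier shape of Literature/Analysis/ValidatedNumerics).

## Two-layer plan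
Layer 1 (now): cruxes NoTypeIBlowup (2), NoTypeII (3, shared), TypeIConcentration (4),
RungReynoldsOne (5); supports CertificateSoundness, ScaledEnergyBound, ErgodicOptimisationDuality,
RungZero, LadderGlue, NoBlowupToClay (shared 0055); Assembly. Layer 2 (only after a crux closes):
split RungReynoldsOne into (moment calculus with remainders on K_C) + (certificate existence at C=1)
+ (interval verification), and further rungs C = 2, 5, 10 as support items.

Rationale: WHY THIS LINE. Type-I exclusion is classically attacked through Liouville theorems for ancient
solutions (KNSS2009, AlbrittonBarker2019; route TypeILiouville cruxes 0057/0058) — open beyond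
symmetric classes. This route imports CONVEX DUALITY / ERGODIC OPTIMISATION (Jenkinson2018;
TobascoGoluskinDoering2018; SOS auxiliary functionals for PDEs: GoluskinFantuzzi2019,
ChernyshenkoEtAl2014, FantuzziGoluskin2020) onto the compact Type-I profile space in Leray
variables: absence of Type-I blow-up at collapse Reynolds number ≤ C becomes a finitely checkable
inequality for an auxiliary functional, sound by telescoping + L³ concentration (BarkerPrange2020
Thm 2, arXiv:1812.09115 pp.4-5) and complete by duality, so Leray's 1934 rate constant (in tree:
leray_blowup_rate_top_holds) is rung 0 of a ladder X_C, C ↑ ∞, whose limit is the crux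
NoTypeIBlowup. Explicit-constant literature the ladder extends: Leray1934 §19 (3.9),
CortissozMonteroPinilla2014, CheskidovZaya2016, doi:10.1063/1.4762841, doi:10.1137/15m1017776 (all
one-line ODE comparisons; every known dimensionless constant is ≪ 1).
RANKED CRUXES. (2) NoTypeIBlowup — the limit; hardest, most informative (a refutation is a Type-I
singularity). (3) NoTypeII — shared stmt-0056; without it X does not reach Clay A. (4)
TypeIConcentration — L³ mass ≥ γ(C)ν³ in balls of radius ρ(C)√(ν(T−t)) around a Type-I(C) singular
point, constants depending on C ONLY (Barker–Prange need the Morrey-type bound (e.typeI) with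
constant M; from the sup-rate only M(M′,u₀,r) is in print — support ScaledEnergyBound claims M =
M(C) eventually). (5) RungReynoldsOne — X_1: no Type-I blow-up with √((T−t)/ν)‖u(t)‖_∞ ≤ 1; first
rung beyond every explicit perturbative constant (mild-formulation comparison gives c ≈ 1/(πκ) <
0.3).
SUPPORTS (do not drive staffing). CertificateSoundness (telescoping theorem, typed trajectory-wise
so no semiflow object is needed); ScaledEnergyBound (Gronwall on local energy from t′ = T − r²/ν
where |u| ≤ Cν/r; pressure via local decomposition); ErgodicOptimisationDuality (Hahn–Banach +
Riesz–Markov on C(K); Mathlib-provable); RungZero (∃ C>0, X_C from leray_blowup_rate_top_holds +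
boundedness on closed sub-strips via far-field ε-regularity); LadderGlue ((∀ C>0, X_C) →
NoTypeIBlowup, bookkeeping, proved in Sketch); NoBlowupToClay (= 0055).
KILL CRITERIA. (i) A Type-I singularity from Schwartz data (¬NoTypeIBlowup; e.g. a Type-I DSS
blow-up, Literature.Analysis.FluidPDE.TypeIDSSLiouvilleConjecture false AND realised from finite
energy) closes the route refuted. (ii) TypeIConcentration refuted (concentration radius not
controlled by C) ⇒ restate the ladder over boxes (C, A) with the Morrey constant A as second index,
or close if no uniform class survives. (iii) METHOD kill (not a refutation of any statement): the
unavoidable closure remainder on K_1 for moment ansätze of degree ≤ 4 exceeds the concentration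
threshold ε(1) — then RungReynoldsOne is unreachable by certificates and the route goes dormant
pending explicit ε-regularity constants two orders better (card's fastest refutation). (iv) NoTypeII
refuted kills every positive route.
CALIBRATION before any rung claim: re-certify known axisymmetric rungs (knss_no_axisymmetric_typeI)
and watch certificates correctly FAIL on the autonomous dyadic profile flow where Type-I-rate
blow-up is a theorem (TruncatedDyadicTypeIBlowup) — slack versus truth.
DELIBERATELY NOT DECOMPOSED. The profile class K_C as a Lean object (derivative bounds C_j(C) by
parabolic smoothing, Morrey bound F(C)); the profile semiflow Φ_h, its C^k_loc-continuity and the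
compactness of the forward-invariant class K_C^+ (KNSS2009 §§2-4 technology) needed to turn
ErgodicOptimisationDuality into NS completeness; the moment calculus (d/ds of Gaussian-weighted
moments of U, Ω, P = polynomial in moments + remainders bounded on K_C); the SDP/SOS search and
interval verification; explicit values of γ_univ, S*(M) (BarkerPrange2020) and of Leray's constant.
No new definitions are requested at open (everything is inlined over accepted decls), so the route
is not blocked on definitions.
NOVELTY/BARRIERS: see the dedicated header sections (searched 2026-08-15: crossref ×6 queries, lit
galaxy ×3, lit frontier/bridges; nearest prior art GoluskinFantuzzi2019 / TobascoGoluskinDoering2018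
/ BarkerPrange2020; grade expected new-combination, as the card's audit).
PRIOR-PROGRAMME NOTES: not read (plancard mode; card + tree + literature only).

Novelty: Nearest prior art: (A) auxiliary-functional / invariant-measure duality and SOS certificates —
Jenkinson2018 (doi:10.1017/etds.2017.142: sup over invariant measures = inf over continuous g of
sup(f + g∘T − g)), TobascoGoluskinDoering2018 (doi:10.1016/j.physleta.2017.12.023),
GoluskinFantuzzi2019 (doi:10.1088/1361-6544/ab018b: SDP auxiliary functionals for a PDE,
Kuramoto–Sivashinsky, via integration by parts on integral functionals — the closest methodological
precedent), FantuzziGoluskin2020, ChernyshenkoEtAl2014; (B) Type-I blow-up analysis — KNSS2009,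
AlbrittonBarker2019, BarkerPrange2020 (arXiv:1812.09115 Thm 2: L³ concentration at the similarity
scale under a Morrey-type Type-I bound), Leray1934 / CortissozMonteroPinilla2014 / CheskidovZaya2016
(explicit rate constants by one-line ODE comparison, all ≪ 1). DELTA: nobody has (i) posed "no
Type-I blow-up with collapse Reynolds number ≤ C" as a certificate problem on the compact
Leray-profile class, (ii) observed that it is COMPLETE by ergodic-optimisation duality (Liouville
theorems replaced by finite inequalities whose failure is only a matter of ansatz degree), or (iii)
used Barker–Prange concentration as the instantaneous non-triviality witness that makes trajectory
certificates sound; the ladder makes Leray's constant rung 0 of a programme with a first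
non-perturbative target X_1. Expected grade: new-combination (A × B), certificate-search flavour
declared (the idea card was audited new-combination, 2026-08-15).
Search  [refs: 10.1017/etds.2017.142:, 10.1016/j.physleta.2017.12.023, 10.1088/1361-6544/ab018b:, 1812.09115, doi:10.1017/etds.2017.142, doi:10.1016/j.physleta.2017.12.023, doi:10.1088/1361-6544/ab018b, Jenkinson2018, TobascoGoluskinDoering2018, GoluskinFantuzzi2019, FantuzziGoluskin2020, ChernyshenkoEtAl2014, KNSS2009, AlbrittonBarker2019, BarkerPrange2020, Leray1934, CortissozMonteroPinilla2014, CheskidovZaya2]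

Barriers (technique_class: certificate-search auxiliary-functional type-I-blowup-rate): technique_class: certificate-search auxiliary-functional type-I-blowup-rate
- Literature.Barriers.NavierStokesRegularity.AxisymmetricTypeIExclusion: consistent, not an
obstruction — in the axisymmetric class every rung X_C is already a theorem (SereginSverak2009 Thm
3.1; in tree knss_no_axisymmetric_typeI), so axisymmetric data are the CALIBRATION suite (a
certificate pipeline that cannot re-certify small axisymmetric rungs is abandoned); genuine rungs
are claimed only on the full non-symmetric class K_C.
- Literature.Barriers.NavierStokesRegularity.TruncatedDyadicTypeIBlowup: the sharpest test — the
exogenously truncated dyadic model blows up at the Type-I/DSS rate, so a certificate built only from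
energy-identity-type inequalities insensitive to averaging AND to time-dependence of the
nonlinearity cannot exist (it would certify the dyadic witness too). Evasion: (a) AUTONOMY is used
essentially — certificates live on the profile flow of the autonomous Leray equation and
completeness is invariant-measure duality for a FIXED continuous map, which a
piecewise-constant-in-time B̃(t) with unboundedly many switches does not have; (b) the witness and
the moment ansatz are physical-space LOCAL quantities (local L³ mass at the similarity scale,
Gaussian-weighted local energy/enstrophy/pressure moments, local energy flux) with no dyadic
analogue; (c) negative control built in: run the same SDP on the autonomous Katz–Pavlović/Tao dyadic
profile flow, where Type-I-rate blow-up is a theo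

Novelty grade: new-combination — ROUTE REVIEW (refuter refuter-rreview-route-KontsevichZagierPe-c59626b6-g2-0, 2026-08-15; concurs with 10c1b6d9-0 and c59626b6-0): KEEP OPEN. 11/11 decls elaborate, 0 refuted, 0 vacuous; 2887 LadderGlue and 2888 Assembly PROVED (candidate proofs attached twice — a prover should land them). Layers ma (refuter refuter-rreview-route-KontsevichZagierPe-c59626b6-g2-0, 2026-08-15T14:05:28Z; prior: Jenkinson2018 doi:10.1017/etds.2017.142 (arXiv:1712.02307 Prop 2.2), TobascoGoluskinDoering2018 doi:10.1016/j.physleta.2017.12.023, GoluskinFantuzzi2019 doi:10.1088/1361-6544/ab018b, BarkerPrange2020 arXiv:1812.09115 Thm 2, Leray1934 §19 (3.8)-(3.9), KNSS2009, AlbrittonBarker2019, SereginSverak2009 Thm 3.1 (axisymmetric calibration))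

History (route lifecycle, newest last):
- 2026-08-15T22:49:53Z · rev 3: restated Assembly (stmt-NavierStokesRegularity-2888 proved) — route-repair glue-native-fail (unit rglue-NavierStokesRegularity-TypeICer-ba288c03): `closes` is byte-identical to rev 2 (native-OK 16:11Z, nonce add843fb1d9998 (planner-rglue-NavierStokesRegularity-TypeICer-ba288c03-0)

sub-problem: NavierStokesRegularity · status: open · opened planner-plancard-NavierStokesRegularity-Navie-2af1cacc-0 2026-08-15T11:09:11Z · rev 4 · ledger route-NavierStokesRegularity-TypeICertificateLadder
GENERATED by the gate from the ledger (D-0016/17). Provers cite these decls: `theorem foo : Summit.NavierStokesRegularity.NavierStokesRegularity.Theses.TypeICertificateLadder.<Decl> := …` in Summits/NavierStokesRegularity/NavierStokesRegularity/Theorems/<Name>.lean.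
-/

namespace Summit.NavierStokesRegularity.NavierStokesRegularity.Theses.TypeICertificateLadder

open scoped BigOperators Topology Manifold Classical MeasureTheory ProbabilityTheory Matrix InnerProductSpace ComplexConjugate ContinuousMap
open Filter Set Function TopologicalSpace MeasureTheory

attribute [summit_statement] _root_.NavierStokesRegularity

open Literature.NS

/-- item stmt-NavierStokesRegularity-1217 · crux · rank 2 · open · by planner
why it might fail: A Type-I singularity may exist: Type-I DSS blow-up is open (TypeIDSSLiouvilleConjecture; ChaeWolf2017 reach only lambda near 1), NontrivialTypeIAncientExists is open (AlbrittonBarker2019 Thm 1.1); even if true the ladder may stall: bounded-degree certificates need not exist uniformly in C.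
sources: KNSS2009, AlbrittonBarker2019, ChaeWolf2017, BradshawTsai2017AHP, SereginSverak2009, arXiv:0709.3599
[target] X = NO TYPE-I BLOW-UP FOR CLAY DATA: a classical solution of unforced NS on ℝ³×[0,T) which
is Leray–Hopf from a rapidly decaying datum and blows up at most at the Type-I rate ‖u(t)‖∞ ≤
C(T−t)^{-1/2} extends smoothly past T. Equals UnthreadedNoBlowup ∧ ThreadedNoBlowup by excluded
middle on 'every point is unthreaded' (proved in the planner's Sketch.lean: target_of_cruxes); it is
the unconditional conclusion of stmt-NavierStokesRegularity-0058 (route TypeILiouville, which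
assumes (L)). With NoTypeII (stmt-0056) it gives NoBlowup (stmt-0054). Card:
threading-flux-trace-topology. -/
@[route_item "route-NavierStokesRegularity-TypeICertificateLadder", crux]
def NoTypeIBlowup : Prop :=
  ∀ (ν T : ℝ), 0 < ν → 0 < T → ∀ (u : ℝ → EuclideanSpace ℝ (Fin 3) → EuclideanSpace ℝ (Fin 3)) (p : ℝ → EuclideanSpace ℝ (Fin 3) → ℝ), Literature.Analysis.FluidPDE.IsClassicalNSSolutionOn (Set.Ico 0 T) ν 0 u p → Literature.Analysis.FluidPDE.IsLerayHopfOn T ν 0 (u 0) u → Literature.Analysis.FluidPDE.HasRapidSpatialDecay (u 0) → Literature.Analysis.FluidPDE.IsTypeIBlowup u T → Literature.Analysis.FluidPDE.HasSmoothExtensionPast ν 0 u T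

/-- item stmt-NavierStokesRegularity-0056 · crux · rank 3 · open · by planner
why it might fail: No theorem bounds a blow-up rate from above; Tao's averaged-NS blow-up is Type II (arXiv:1402.0290 p.8 fn.), every axisymmetric singularity must be Type II (KNSS2009 p.4), so Hou's candidate (arXiv:2107.06509), if real, refutes it (= not Clay A).
sources: Tao2016AveragedNS, KNSS2009, arXiv:2107.06509, Seregin2012, Literature.Barriers.NavierStokesRegularity.EnergySupercriticality
If a finite-energy classical solution from a rapidly decaying datum has maximal lifespan T<∞ (no
classical extension past T), then ‖u(t)‖_∞ ≤ C (T−t)^{-1/2} eventually as t↑T (Leray's rate is the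
matching lower bound, leray_blowup_rate_top). The hardest and most informative crux: a
counterexample is a Type II singularity, i.e. ¬(Clay A). Known: lower bound c√ν (T−t)^{-1/2} (Leray
1934 §20); L³ must blow up (ESS 2003, Seregin 2012); only triple-log quantitative gain (Tao 2021). -/
@[route_item "route-NavierStokesRegularity-TypeICertificateLadder", crux]
def NoTypeII : Prop :=
  ∀ (ν T : ℝ), 0 < ν → 0 < T → ∀ (u : ℝ → EuclideanSpace ℝ (Fin 3) → EuclideanSpace ℝ (Fin 3)) (p : ℝ → EuclideanSpace ℝ (Fin 3) → ℝ), Literature.Analysis.FluidPDE.IsMaximalSmoothSolution ν 0 u p T → Literature.Analysis.FluidPDE.IsLerayHopfOn T ν 0 (u 0) u → Literature.Analysis.FluidPDE.HasRapidSpatialDecay (u 0) → Literature.Analysis.FluidPDE.IsTypeIBlowup u T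

/-- item stmt-NavierStokesRegularity-2881 · crux · rank 4 · closed · proved by Summit.NavierStokesRegularity.NavierStokesRegularity.Theorems.typeIConcentration_proof (prover) · by planner
why it might fail: BarkerPrange2020 Thm 2 needs the Morrey-type bound (e.typeI) with constant M; from the sup-rate alone only a solution-dependent M(M',u0,r) is in print (arXiv:1812.09115 p.5, Seregin-Zajaczkowski), so rho=rho(C) hinges on the new uniform ScaledEnergyBound; gamma_univ is minute (slack).
sources: BarkerPrange2020, arXiv:1812.09115, AlbrittonBarker2019, CKN1982, SereginSverak2009, RusinSverak2011
NON-TRIVIALITY WITNESS of the certificate method: at a Type-I(C) blow-up (eventual √(T−t)‖u(t)‖_∞ ≤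
C√ν, no classical extension past T) there is a point x₀ such that the scale-invariant local L³ mass
ν⁻³∫_{B(x₀,ρ√(ν(T−t)))}|u(t)|³dx = ∫_{|y|<ρ}|U(s,y)|³dy stays ≥ γ for all t near T, with ρ, γ
depending on C ONLY. Route to it: (i) no extension ⇒ a singular point (T,x₀) exists (continuation of
bounded classical Leray–Hopf solutions, hasSmoothExtensionPast_of_bounded_holds, + far-field
ε-regularity, LerayFarFieldEpsilonRegularity); (ii) support ScaledEnergyBound gives Barker–Prange's
Morrey-type Type-I condition (e.typeI) with M = M(C); (iii) BarkerPrange2020 Thm 2 (arXiv:1812.09115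
pp.4-5): ‖u(t)‖_{L³(|x−x₀| ≤ 2√((T−t)/S*(M)))} > γ_univ for t ∈ (t_*,T), γ_univ universal; so ρ =
2/√(S*(M(C))) (ν = 1 there; ν-scaling gives the factor ν³), γ = γ_univ³. Expected to land as a named
Literature fact for (iii) plus glue; the grounder may restate this item with (h : that fact) →. -/
@[route_item "route-NavierStokesRegularity-TypeICertificateLadder"]
def TypeIConcentration : Prop :=
  ∀ C : ℝ, 0 < C → ∃ ρ : ℝ, 0 < ρ ∧ ∃ γ : ℝ, 0 < γ ∧ ∀ (ν T : ℝ), 0 < ν → 0 < T → ∀ (u : ℝ → EuclideanSpace ℝ (Fin 3) → EuclideanSpace ℝ (Fin 3)) (p : ℝ → EuclideanSpace ℝ (Fin 3) → ℝ), Literature.Analysis.FluidPDE.IsClassicalNSSolutionOn (Set.Ico 0 T) ν 0 u p → Literature.Analysis.FluidPDE.IsLerayHopfOn T ν 0 (u 0) u → Literature.Analysis.FluidPDE.HasRapidSpatialDecay (u 0) → (∀ᶠ t in 𝓝[<] T, ∀ x, Real.sqrt (T - t) * ‖u t x‖ ≤ C * Real.sqrt ν) → ¬ Literature.Analysis.FluidPDE.HasSmoothExtensionPast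 ν 0 u T → ∃ x₀ : EuclideanSpace ℝ (Fin 3), ∀ᶠ t in 𝓝[<] T, γ * ν ^ 3 ≤ ∫ x in Metric.ball x₀ (ρ * Real.sqrt (ν * (T - t))), ‖u t x‖ ^ 3

/-- item stmt-NavierStokesRegularity-2882 · crux · rank 5 · closed · proved by Summit.NavierStokesRegularity.NavierStokesRegularity.Theorems.typeICertificateLadder_rungReynoldsOne (prover) · by planner
why it might fail: No tractable-degree certificate may exist at C=1: closure remainders on the infinite-dimensional K_1 must beat the tiny threshold eps(1) (gamma_univ of BarkerPrange2020: non-explicit, minute); analytically nothing beyond perturbative constants <0.3 is known (Leray1934 (3.9); ChaeWolf2017 Rmk 1.4).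
sources: Leray1934, CortissozMonteroPinilla2014, CheskidovZaya2016, doi:10.1063/1.4762841, doi:10.1137/15m1017776, ChaeWolf2017
RUNG ONE of the ladder, X_1: no finite-energy classical solution from a rapidly decaying datum blows
up at T with collapse Reynolds number ≤ 1, i.e. with √(T−t)‖u(t)‖_∞ ≤ √ν near T. Rung 0 (support
RungZero, Leray 1934) gives X_C only below a small non-explicit constant; every explicit constant in
print (CortissozMonteroPinilla2014, CheskidovZaya2016, doi:10.1063/1.4762841,
doi:10.1137/15m1017776; mild-formulation comparison c ≈ 1/(πκ), κ ≥ ‖∇G₁‖_{L¹(ℝ³)} ≈ 1.13) is < 0.3,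
so C = 1 is the first genuinely non-perturbative target. Intended proof: a-priori bounds placing
U(s) in the profile class K_1 (parabolic smoothing + ScaledEnergyBound); an SOS/SDP certificate g =
polynomial in Gaussian/Hermite-weighted local moments of (U, curl U, P) satisfying the pointwise
Lie-derivative inequality on K_1 (moment calculus with remainders, interval-verified via kit
compute, Verifier shape of Literature/Analysis/ValidatedNumerics); then CertificateSoundness. An
analytic improvement of Leray's constant to 1 closes it just as well. CALIBRATE FIRST: axisymmetric
rungs (known true) and the autonomous dyadic profile flow (known Type-I blow-up; certificates must
fail). -/
@[route_item "route-NavierStokesRegularity-TypeICertificateLadder"]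
def RungReynoldsOne : Prop :=
  ∀ (ν T : ℝ), 0 < ν → 0 < T → ∀ (u : ℝ → EuclideanSpace ℝ (Fin 3) → EuclideanSpace ℝ (Fin 3)) (p : ℝ → EuclideanSpace ℝ (Fin 3) → ℝ), Literature.Analysis.FluidPDE.IsClassicalNSSolutionOn (Set.Ico 0 T) ν 0 u p → Literature.Analysis.FluidPDE.IsLerayHopfOn T ν 0 (u 0) u → Literature.Analysis.FluidPDE.HasRapidSpatialDecay (u 0) → (∀ᶠ t in 𝓝[<] T, ∀ x, Real.sqrt (T - t) * ‖u t x‖ ≤ Real.sqrt ν) → Literature.Analysis.FluidPDE.HasSmoothExtensionPast ν 0 u T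

/-- `RungReynoldsOne` holds: proved by `Summit.NavierStokesRegularity.NavierStokesRegularity.Theorems.typeICertificateLadder_rungReynoldsOne`. -/
theorem RungReynoldsOne_holds : RungReynoldsOne := _root_.Summit.NavierStokesRegularity.NavierStokesRegularity.Theorems.typeICertificateLadder_rungReynoldsOne

/-- item stmt-NavierStokesRegularity-2883 · support · rank 6 · closed · proved by Summit.NavierStokesRegularity.NavierStokesRegularity.Theorems.typeICertificateLadder_certificateSoundness_proof @ 8929203f8ec3 (prover) · by planner
why it might fail: Only through TypeIConcentration (rank 4); the telescoping itself is bookkeeping.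
sources: TobascoGoluskinDoering2018, GoluskinFantuzzi2019, BarkerPrange2020, Jenkinson2018
SOUNDNESS OF TRAJECTORY CERTIFICATES (the mechanism's theorem, typed without any semiflow object).
For every C>0 there are ε(C)>0 and ρ(C)>0 such that: if δ<ε and g is a real functional bounded on {V
: ‖V‖_∞ ≤ C} satisfying, along every classical Leray–Hopf rapidly-decaying-datum solution with
eventual rate √(T−t)‖u‖ ≤ C√ν and every centre x₀, g(U(s₂)) − g(U(s₁)) +
∫_{s₁}^{s₂}∫_{|y|<ρ}|U(s,y)|³dy ds ≤ δ(s₂−s₁) for all s₀ ≤ s₁ ≤ s₂ (U = Leray profile at (T,x₀):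
U(s,y) = √(Te^{-s}/ν) u(T−Te^{-s}, x₀+√(νTe^{-s})y), T − t = Te^{-s}), then X_C holds. Proof:
telescoping gives (1/S)∫_{s₁}^{s₁+S} f_ρ(U) ≤ δ + 2M/S, while at a singular point TypeIConcentration
gives f_ρ(U(s)) ≥ γ =: ε eventually — contradiction; so no singular point, hence extension.
Certificates are produced by SOS on the profile class K_C as POINTWISE Lie-derivative inequalities
Dg(V)[ΔV − ½V − ½y·∇V − V·∇V − ∇P] + f_ρ(V) ≤ δ (GoluskinFantuzzi2019 pattern for PDE integral
functionals), which integrate to the trajectory form from the settling time s₀ on. -/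
@[route_item "route-NavierStokesRegularity-TypeICertificateLadder"]
def CertificateSoundness : Prop :=
  ∀ C : ℝ, 0 < C → ∃ ε : ℝ, 0 < ε ∧ ∃ ρ : ℝ, 0 < ρ ∧ ∀ δ : ℝ, δ < ε → ∀ g : (EuclideanSpace ℝ (Fin 3) → EuclideanSpace ℝ (Fin 3)) → ℝ, (∃ M : ℝ, ∀ V : EuclideanSpace ℝ (Fin 3) → EuclideanSpace ℝ (Fin 3), (∀ y, ‖V y‖ ≤ C) → |g V| ≤ M) → (∀ (ν T : ℝ), 0 < ν → 0 < T → ∀ (u : ℝ → EuclideanSpace ℝ (Fin 3) → EuclideanSpace ℝ (Fin 3)) (p : ℝ → EuclideanSpace ℝ (Fin 3) → ℝ), Literature.Analysis.FluidPDE.IsClassicalNSSolutionOn (Set.Ico 0 T) ν 0 u p → Literature.Analysis.FluidPDE.IsLerayHopfOn T ν 0 (u 0) u → Literature.Analysis.FluidPDE.HasRapidSpatialDecay (u 0) → (∀ᶠ t in 𝓝[<] T, ∀ x, Real.sqrt (T - t) * ‖u t x‖ ≤ C * Real.sqrt ν) → ∀ x₀ : EuclideanSpace ℝ (Fin 3),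 let U : ℝ → EuclideanSpace ℝ (Fin 3) → EuclideanSpace ℝ (Fin 3) := fun s y => Real.sqrt (T * Real.exp (-s) / ν) • u (T - T * Real.exp (-s)) (x₀ + Real.sqrt (ν * T * Real.exp (-s)) • y); ∃ s₀ : ℝ, ∀ s₁ s₂ : ℝ, s₀ ≤ s₁ → s₁ ≤ s₂ → g (U s₂) - g (U s₁) + (∫ s in s₁..s₂, ∫ y in Metric.ball (0 : EuclideanSpace ℝ (Fin 3)) ρ, ‖U s y‖ ^ 3) ≤ δ * (s₂ - s₁)) → ∀ (ν T : ℝ), 0 < ν → 0 < T → ∀ (u : ℝ → EuclideanSpace ℝ (Fin 3) → EuclideanSpace ℝ (Fin 3)) (p : ℝ → EuclideanSpace ℝ (Fin 3) → ℝ), Literature.Analysis.FluidPDE.IsClassicalNSSolutionOn (Set.Ico 0 T) ν 0 u p → Literature.Analysis.FluidPDE.IsLerayHopfOn T ν 0 (u 0) u → Literature.Analysis.FluidPDE.HasRapidSpatialDecay (u 0) → (∀ᶠ t in 𝓝[<] T, ∀ x, Real.sqrt (T - t) * ‖u t x‖ ≤ C * Real.sqrt ν) → Literature.Analysis.FluidPDE.HasSmoothExtensionPast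 ν 0 u T

/-- item stmt-NavierStokesRegularity-2884 · support · rank 7 · closed · proved by Summit.NavierStokesRegularity.NavierStokesRegularity.Theorems.typeICertificateLadder_scaledEnergyBound_proof (prover) · by planner
why it might fail: Pressure far-field terms in the local-energy Gronwall might not close linearly at all scales r<=r0 uniformly in the centre; the literature states only solution-dependent constants (arXiv:1812.09115 p.5).
sources: BarkerPrange2020, arXiv:1812.09115, AlbrittonBarker2019, CKN1982, LemarieRieusset2002
UNIFORM MORREY BOUND for Type-I(C) solutions: for every C there is A = A(C) such that along any
classical Leray–Hopf rapidly-decaying-datum solution with eventual rate √(T−t)‖u‖ ≤ C√ν one has, for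
some r₀>0 and all t near T, all centres x₀ and radii 0<r≤r₀: r⁻¹∫_{B_r(x₀)}|u(t)|² ≤ Aν². This is
Barker–Prange's Type-I condition (e.typeI) (arXiv:1812.09115 p.4) with M² = A, but with M depending
on C only — in print only M(M′,u₀,r) (ibid. p.5; Seregin–Zajaczkowski; Seregin 2018 pp.844-849).
Sketch: with r₀ := √(ν(T−t₁)) (t₁ = onset of the rate) and r ≤ r₀ start at t′ = T − r²/ν, where the
rate gives |u(t′)| ≤ Cν/r and r⁻¹∫_{B_2r}|u(t′)|² ≤ 34C²ν²; propagate to t by the local energy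
inequality: cubic flux and pressure terms (local Riesz part + harmonic far part, sup over centres)
are LINEAR in e(s) = sup_{x₀}∫_{B_2r(x₀)}|u(s)|² with coefficient ≲ ‖u(s)‖_∞/r ≤ C√ν/(r√(T−s)),
whose integral over (t′,T) is 2C; Gronwall gives A(C) ≲ C²e^{κC}. Radii r ≤ √(ν(T−t)) are trivial
from the pointwise rate. Feeds TypeIConcentration and defines the certificate class K_C. -/
@[route_item "route-NavierStokesRegularity-TypeICertificateLadder", crux]
def ScaledEnergyBound : Prop :=
  ∀ C : ℝ, 0 < C → ∃ A : ℝ, ∀ (ν T : ℝ), 0 < ν → 0 < T → ∀ (u : ℝ → EuclideanSpace ℝ (Fin 3) → EuclideanSpace ℝ (Fin 3)) (p : ℝ → EuclideanSpace ℝ (Fin 3) → ℝ), Literature.Analysis.FluidPDE.IsClassicalNSSolutionOn (Set.Ico 0 T) ν 0 u p → Literature.Analysis.FluidPDE.IsLerayHopfOn T ν 0 (u 0) u → Literature.Analysis.FluidPDE.HasRapidSpatialDecay (u 0) → (∀ᶠ t in 𝓝[<] T, ∀ x, Real.sqrt (T - t) * ‖u t x‖ ≤ C * Real.sqrt ν)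 → ∃ r₀ : ℝ, 0 < r₀ ∧ ∀ᶠ t in 𝓝[<] T, ∀ x₀ : EuclideanSpace ℝ (Fin 3), ∀ r : ℝ, 0 < r → r ≤ r₀ → r⁻¹ * (∫ x in Metric.ball x₀ r, ‖u t x‖ ^ 2) ≤ A * ν ^ 2

/-- item stmt-NavierStokesRegularity-2885 · support · rank 8 · closed · proved by Summit.NavierStokesRegularity.NavierStokesRegularity.Theorems.typeICertificateLadder_ergodicOptimisationDuality_proof (prover) · by planner
why it might fail: None expected (standard functional analysis: Hahn-Banach + Riesz-Markov); K empty is vacuous.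
sources: Jenkinson2018, arXiv:1712.02307, TobascoGoluskinDoering2018, doi:10.3934/dcds.2006.15.197
COMPLETENESS CORE (abstract, Mathlib-provable): for a continuous self-map Φ of a compact metric
space K and continuous F, if every Φ-invariant Borel probability μ has ∫F dμ < β then some
CONTINUOUS g has F(x) + g(Φx) − g(x) < β for all x — the non-trivial half of the duality sup_μ ∫F dμ
= inf_{g∈C(K)} sup_x (F + g∘Φ − g). Proof (constructive; Jenkinson2018 = arXiv:1712.02307 Prop 2.2
p.4: β(F) = limsup_n (1/n) sup_x S_nF, S_nF = Σ_{i<n} F∘Φ^i): pick n with (1/n) sup_x S_nF < β and g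
:= (1/n) Σ_{j<n} S_jF, so F + g∘Φ − g = (1/n) S_nF; the limsup identity is Krylov–Bogolyubov on
empirical measures of near-maximisers (weak-* compactness, Riesz–Markov). Flow version:
TobascoGoluskinDoering2018. Applied (NOT decomposed here) to the time-h map of the Leray profile
flow on the compact forward-invariant class K_C^+ (KNSS2009 §§2-4 technology), F = ∫_0^h f_ρ∘Φ_σ dσ:
level-C certificates exist for all δ>0 as soon as the invariant core (eternal Type-I(C) profiles =
ancient solutions with |u| ≤ C√(ν/(−t))) carries no invariant measure with positive witness — the
certificate class is COMPLETE relative to the level-C Liouville statement: failure to certify is a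
matter of degree, not of kind. -/
@[route_item "route-NavierStokesRegularity-TypeICertificateLadder"]
def ErgodicOptimisationDuality : Prop :=
  ∀ (K : Type) [MetricSpace K] [CompactSpace K] [MeasurableSpace K] [BorelSpace K] (Φ : K → K), Continuous Φ → ∀ F : K → ℝ, Continuous F → ∀ β : ℝ, (∀ μ : MeasureTheory.Measure K, MeasureTheory.IsProbabilityMeasure μ → MeasureTheory.Measure.map Φ μ = μ → ∫ x, F x ∂μ < β) → ∃ g : K → ℝ, Continuous g ∧ ∀ x : K, F x + g (Φ x) - g x < β

/-- item stmt-NavierStokesRegularity-2886 · support · rank 9 · closed · proved by Summit.NavierStokesRegularity.NavierStokesRegularity.Theorems.typeICertificateLadder_rungZero (prover) · by planner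
why it might fail: Only the sub-strip boundedness glue; the rate bound itself is proved in tree (leray_blowup_rate_top_holds).
sources: Leray1934, OzanskiPooley2018, RobinsonRodrigoSadowski2016
RUNG ZERO (Leray 1934 §19 (3.9); in tree leray_blowup_rate_top with its discharge
leray_blowup_rate_top_holds, NSLerayBlowupRateTopHolds.lean): some positive collapse Reynolds number
C₀ is excluded — with c the constant of leray_blowup_rate_top take C₀ = c/2: if the solution did not
extend it would be maximal, and Leray's lower bound ‖u(t)‖_∞ ≥ c√ν/√(T−t) contradicts the eventual
rate. The one non-trivial glue is the fact's hypothesis that u is essentially bounded on every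
closed sub-strip [0,T′]×ℝ³: near T′ from the rate, on [0,t₁] from continuity plus far-field
ε-regularity / decay of Leray–Hopf solutions from rapidly decaying data
(LerayFarFieldEpsilonRegularity; hasSmoothExtensionPast_of_bounded_holds pattern). Cheap; shows the
ladder has a non-empty base. -/
@[route_item "route-NavierStokesRegularity-TypeICertificateLadder"]
def RungZero : Prop :=
  ∃ C : ℝ, 0 < C ∧ ∀ (ν T : ℝ), 0 < ν → 0 < T → ∀ (u : ℝ → EuclideanSpace ℝ (Fin 3) → EuclideanSpace ℝ (Fin 3)) (p : ℝ → EuclideanSpace ℝ (Fin 3) → ℝ), Literature.Analysis.FluidPDE.IsClassicalNSSolutionOn (Set.Ico 0 T) ν 0 u p → Literature.Analysis.FluidPDE.IsLerayHopfOn T ν 0 (u 0) u → Literature.Analysis.FluidPDE.HasRapidSpatialDecay (u 0) → (∀ᶠ t in 𝓝[<] T, ∀ x, Real.sqrt (T - t) * ‖u t x‖ ≤ C * Real.sqrt ν) → Literature.Analysis.FluidPDE.HasSmoothExtensionPast ν 0 u T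

/-- `RungZero` holds: proved by `Summit.NavierStokesRegularity.NavierStokesRegularity.Theorems.typeICertificateLadder_rungZero`. -/
theorem RungZero_holds : RungZero := _root_.Summit.NavierStokesRegularity.NavierStokesRegularity.Theorems.typeICertificateLadder_rungZero

/-- item stmt-NavierStokesRegularity-2887 · support · rank 10 · closed · proved by Summit.NavierStokesRegularity.NavierStokesRegularity.Theorems.typeICertificateLadder_ladderGlue_proof (prover) · by planner
why it might fail: Bookkeeping only (proved in the planner sketch).
sources: Leray1934, KNSS2009
THE LADDER TEMPLATE: the rung statement X_C (eventual dimensionless rate √(T−t)‖u(t,x)‖ ≤ C√ν ⇒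
classical extension past T) for ALL C>0 implies the crux NoTypeIBlowup (IsTypeIBlowup gives ‖u‖ ≤
C′/√(T−t) eventually; take C = max(C′/√ν, 1)). Pure bookkeeping — a 12-line proof is in the
planner's Sketch.lean; filed so that the exact rung shape is pinned once in the route file (rung C =
1 is the crux RungReynoldsOne; rungs C = 2, 5, 10 become support items in tenure as certificates
land). -/
@[route_item "route-NavierStokesRegularity-TypeICertificateLadder"]
def LadderGlue : Prop :=
  (∀ C : ℝ, 0 < C → ∀ (ν T : ℝ), 0 < ν → 0 < T → ∀ (u : ℝ → EuclideanSpace ℝ (Fin 3) → EuclideanSpace ℝ (Fin 3)) (p : ℝ → EuclideanSpace ℝ (Fin 3) → ℝ), Literature.Analysis.FluidPDE.IsClassicalNSSolutionOn (Set.Ico 0 T) ν 0 u p → Literature.Analysis.FluidPDE.IsLerayHopfOn T ν 0 (u 0) u → Literature.Analysis.FluidPDE.HasRapidSpatialDecay (u 0) → (∀ᶠ t in 𝓝[<] T, ∀ x, Real.sqrt (T - t) * ‖u t x‖ ≤ C * Real.sqrt ν) → Literature.Analysis.FluidPDE.HasSmoothExtensionPast ν 0 u T) → NoTypeIBlowu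p

/-- `LadderGlue` holds: proved by `Summit.NavierStokesRegularity.NavierStokesRegularity.Theorems.typeICertificateLadder_ladderGlue_proof`. -/
theorem LadderGlue_holds : LadderGlue := _root_.Summit.NavierStokesRegularity.NavierStokesRegularity.Theorems.typeICertificateLadder_ladderGlue_proof

/-- item stmt-NavierStokesRegularity-0055 · support · rank 11 · closed · proved by Summit.NavierStokesRegularity.NavierStokesRegularity.Theorems.typeICertificateLadder_noBlowupToClay_proof @ f501e9774e4d (prover) · by planner
why it might fail: Standard but not yet in tree (shared with routes TypeILiouville, MonotoneCritical).
sources: Leray1934, Fefferman2000, RobinsonRodrigoSadowski2016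
Given NoBlowup, build the Clay (A) solution: local finite-energy classical solution for smooth
divergence-free rapidly decaying data (Leray 1934 §III / Fujita–Kato 1964 + LPS smoothing), continue
past every T using NoBlowup, glue by weak–strong uniqueness (Prodi–Serrin), bounded energy from the
energy inequality, and convert with
Literature.Analysis.FluidPDE.isNavierStokesSolution_and_smooth_iff. Blow-up at spatial infinity is
excluded by CKN ε-regularity applied far out. May take named Literature facts (leray_existence_R3,
ladyzhenskaya_prodi_serrin, weak_strong_uniqueness, fujita_kato_local) as hypotheses if the grounder
so rules. -/
@[route_item "route-NavierStokesRegularity-TypeICertificateLadder", crux]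
def NoBlowupToClay : Prop :=
  (∀ (ν T : ℝ), 0 < ν → 0 < T → ∀ (u : ℝ → EuclideanSpace ℝ (Fin 3) → EuclideanSpace ℝ (Fin 3)) (p : ℝ → EuclideanSpace ℝ (Fin 3) → ℝ), Literature.Analysis.FluidPDE.IsClassicalNSSolutionOn (Set.Ico 0 T) ν 0 u p → Literature.Analysis.FluidPDE.IsLerayHopfOn T ν 0 (u 0) u → Literature.Analysis.FluidPDE.HasRapidSpatialDecay (u 0) → Literature.Analysis.FluidPDE.HasSmoothExtensionPast ν 0 u T) → NavierStokesRegularity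

/-- item stmt-NavierStokesRegularity-14842 · support · rank 12 · open · by planner
why it might fail: A Type-I singularity with collapse Reynolds number stuck above 1 may exist (Type-I DSS blow-up is open: TypeIDSSLiouvilleConjecture; NontrivialTypeIAncientExists open, AlbrittonBarker2019 Thm 1.1); with rung 1 in, this IS NoTypeIBlowup — no easier.
sources: KNSS2009, AlbrittonBarker2019, BarkerPrange2020, SereginSverak2009, TobascoGoluskinDoering2018, GoluskinFantuzzi2019
[support] DESCENT TO RUNG ONE — the residual of the crux NoTypeIBlowup above rung 1 (added
2026-08-16 by the route-repair planner, unused-crux RungReynoldsOne). For every C ≥ 1: a classical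
solution of unforced NS on ℝ³×[0,T), Leray–Hopf from a rapidly decaying datum, with eventual
dimensionless rate √(T−t)‖u(t,x)‖ ≤ C√ν which does NOT extend smoothly past T, eventually satisfies
√(T−t)‖u(t,x)‖ ≤ √ν — a Type-I singularity cannot sustain collapse Reynolds number above 1 (in Leray
similarity variables: singular profile trajectories in K_C are eventually absorbed into {‖U‖∞ ≤ 1}).
LOGICAL POSITION (checked in the planner's Sketch.lean, rc0, standard axioms): NoTypeIBlowup →
DescentToRungOne (vacuously, via Theorems typeICertificateLadder_rung_of_noTypeIBlowup) and
RungReynoldsOne → DescentToRungOne → NoTypeIBlowup (item RungOneSplice), so NoTypeIBlowup ↔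
RungReynoldsOne ∧ DescentToRungOne: this item is EXACTLY what remains of the rank-2 crux once rung 1
is in (rung 1 = stmt-NavierStokesRegularity-2882 has two kernel-checked proofs attached as evidence,
L^{5/2}-vorticity budget, awaiting landing). Per level it is strictly weaker than the exclusion
rungs (X_{C₁} ⇒ 'Type-I(C₁) singular ⇒ -/
@[route_item "route-NavierStokesRegularity-TypeICertificateLadder"]
def DescentToRungOne : Prop :=
  ∀ C : ℝ, 1 ≤ C → ∀ (ν T : ℝ), 0 < ν → 0 < T → ∀ (u : ℝ → EuclideanSpace ℝ (Fin 3) → EuclideanSpace ℝ (Fin 3)) (p : ℝ → EuclideanSpace ℝ (Fin 3) → ℝ), Literature.Analysis.FluidPDE.IsClassicalNSSolutionOn (Set.Ico 0 T) ν 0 u p → Literature.Analysis.FluidPDE.IsLerayHopfOn T ν 0 (u 0) u → Literature.Analysis.FluidPDE.HasRapidSpatialDecay (u 0) → (∀ᶠ t in 𝓝[<] T, ∀ x, Real.sqrt (T - t) * ‖u t x‖ ≤ C * Real.sqrt ν) → ¬ Literature.Analysis.FluidPDE.HasSmoothExtensionPast ν 0 u T → ∀ᶠ t in 𝓝[<]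 T, ∀ x, Real.sqrt (T - t) * ‖u t x‖ ≤ Real.sqrt ν

/-- item stmt-NavierStokesRegularity-14843 · support · rank 13 · closed · proved by Summit.NavierStokesRegularity.NavierStokesRegularity.Theorems.typeICertificateLadder_rungOneSplice_proof (prover) · by planner
why it might fail: Bookkeeping only (proved in the planner's Sketch.lean from LadderGlue_holds + nesting of rungs); fails only if a premise is restated.
sources: Leray1934, KNSS2009
[support] RUNG-ONE SPLICE (glue; added 2026-08-16 by the route-repair planner so that the crux
RungReynoldsOne feeds the `closes` hypothesis NoTypeIBlowup): RungReynoldsOne → DescentToRungOne →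
NoTypeIBlowup. Proof (bookkeeping, 12 lines, rc0 with standard axioms in the planner's Sketch.lean,
attached as evidence on this item — a prover lands it with every route Prop expanded verbatim and no
Theses import, pattern of Theorems/TypeICertificateLadderLadderGlue.lean): by LadderGlue (_holds) it
suffices to prove every rung X_C, C > 0; given a Type-I(C) classical Leray–Hopf
rapidly-decaying-datum solution that did not extend, raise the level to max(C,1) (rungs are nested:
Theorems typeICertificateLadder_rung_mono), descend to rung 1 by DescentToRungOne, extend by
RungReynoldsOne — contradiction. BOTH premises are used (DescentToRungOne alone yields only the
eventual rate ≤ √ν, and RungZero's constant C₀ is not known to reach 1), and the converse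
NoTypeIBlowup → RungReynoldsOne ∧ DescentToRungOne holds (Sketch:
noTypeIBlowup_iff_rungOne_and_descent), so the splice loses nothing: it is the formal statement that
rung 1 is the base of the ladder whose remaining height is DescentToRungOne. [ -/
@[route_item "route-NavierStokesRegularity-TypeICertificateLadder"]
def RungOneSplice : Prop :=
  RungReynoldsOne → DescentToRungOne → NoTypeIBlowup

/-- `RungOneSplice` holds: proved by `Summit.NavierStokesRegularity.NavierStokesRegularity.Theorems.typeICertificateLadder_rungOneSplice_proof`. -/
theorem RungOneSplice_holds : RungOneSplice := _root_.Summit.NavierStokesRegularity.NavierStokesRegularity.Theorems.typeICertificateLadder_rungOneSplice_proof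

-- earlier Assembly (stmt-NavierStokesRegularity-2888, replaced 2026-08-15T22:49:53Z -> stmt-NavierStokesRegularity-13893): proved by Summit.NavierStokesRegularity.NavierStokesRegularity.Theorems.typeICertificateLadder_assembly_proof @ 141f3d75be9e — NoTypeIBlowup → NoTypeII → NoBlowupToClay → NavierStokesRegularity
/-- item stmt-NavierStokesRegularity-13893 · assembly · rank 1 · closed · proved by Summit.NavierStokesRegularity.NavierStokesRegularity.Theorems.typeICertificateLadder_ladderAssembly (prover) · by planner
sources: Fefferman2000
LADDER ASSEMBLY (restated 2026-08-15 by the route-repair planner, unit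
rglue-NavierStokesRegularity-TypeICer-ba288c03; deciding theorem `closes` unchanged): every rung
X_C, C > 0 (eventual dimensionless rate √(T−t)‖u(t,x)‖ ≤ C√ν ⇒ classical extension past T — the
exact rung shape pinned in LadderGlue, with RungReynoldsOne = X_1 and RungZero = some X_{C₀})
together with LadderGlue (all rungs ⇒ NoTypeIBlowup), the shared crux NoTypeII (stmt-0056) and the
shared frame NoBlowupToClay (stmt-0055) gives Clay (A). Pure bookkeeping, one line from the deciding
theorem: `fun hR hLG hII hClay => closes (hLG hR) hII hClay` (checked in the planner's Sketch.lean,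
rc 0). It replaces the earlier assembly `NoTypeIBlowup → NoTypeII → NoBlowupToClay →
NavierStokesRegularity` (stmt-NavierStokesRegularity-2888, proved 2026-08-15 by
Theorems/TypeICertificateLadderAssembly.lean via `exact closes`), which was literally the type of
`closes` and left the ladder items without a formal consumer in this file; the ladder form records
how the rungs assemble. LANDING NOTE (provers): as of 2026-08-15T22:31Z a proof of a route item
living in a module that `import`s this route file makes the gate's `<Decl>_holds` li -/
@[route_item "route-NavierStokesRegularity-TypeICertificateLadder"]
def Assembly : Prop :=
  (∀ C : ℝ, 0 < C → ∀ (ν T : ℝ), 0 < ν → 0 < T → ∀ (u : ℝ → EuclideanSpace ℝ (Fin 3) → EuclideanSpace ℝ (Fin 3)) (p : ℝ → EuclideanSpace ℝ (Fin 3) → ℝ), Literature.Analysis.FluidPDE.IsClassicalNSSolutionOn (Set.Ico 0 T) ν 0 u p → Literature.Analysis.FluidPDE.IsLerayHopfOn T ν 0 (u 0) u → Literature.Analysis.FluidPDE.HasRapidSpatialDecay (u 0) → (∀ᶠ t in 𝓝[<] T, ∀ x, Real.sqrt (T - t) * ‖u t x‖ ≤ C * Real.sqrt ν) → Literature.Analysis.FluidPDE.HasSmoothExtensionPast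 ν 0 u T) → LadderGlue → NoTypeII → NoBlowupToClay → NavierStokesRegularity

/-- `Assembly` holds: proved by `Summit.NavierStokesRegularity.NavierStokesRegularity.Theorems.typeICertificateLadder_ladderAssembly`. -/
theorem Assembly_holds : Assembly := _root_.Summit.NavierStokesRegularity.NavierStokesRegularity.Theorems.typeICertificateLadder_ladderAssembly

/-! D-0027 §2.1 — DECIDING THEOREM (planner-authored via `route open/edit --closes-file`; by planner-rrepair-NavierStokesRegularity-TypeICe-2fa30b0f-0 2026-08-16T06:34:30Z):
its hypotheses are this route's items and its conclusion the sub-problem Statement (glue_lint), and it elaborates with this file. -/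

/-- DECIDING THEOREM (D-0027 §2.1): pure logic. `NoBlowupToClay` (= stmt-NavierStokesRegularity-0055)
reduces Clay (A) to "every classical Leray–Hopf rapidly-decaying-datum solution on `[0,T)` extends
past `T`"; if such a solution did not extend it would be a maximal smooth solution
(`IsMaximalSmoothSolution` := classical on `Ico 0 T` ∧ ¬ `HasSmoothExtensionPast`), hence Type I by
`NoTypeII` (= stmt-0056), hence it extends by `NoTypeIBlowup` (= stmt-1217) — contradiction. -/
@[closes "route-NavierStokesRegularity-TypeICertificateLadder"] theorem closes (hI : NoTypeIBlowup) (hII : NoTypeII) (hClay : NoBlowupToClay) :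
    NavierStokesRegularity := by
  apply hClay
  intro ν T hν hT u p hcl hLH hdec
  by_contra hext
  exact hext (hI ν T hν hT u p hcl hLH hdec (hII ν T hν hT u p ⟨hcl, hext⟩ hLH hdec))

end Summit.NavierStokesRegularity.NavierStokesRegularity.Theses.TypeICertificateLadder
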